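import Literature.NumberTheory.EllipticCurves.BhargavaShankarAveragingRegion
import Literature.NumberTheory.EllipticCurves.BinaryQuarticFormsProofs
import Literature.LinearAlgebra.Matrix.GL2ZTraceZeroNormalForms
import Mathlib.Analysis.SpecialFunctions.Pow.Real
import HarnessLib

/-!
# `GL₂(ℤ)`-orbits of integral binary quartic forms with a big stabilizer are negligible
# (an elementary substitute for Bhargava–Shankar, Lemma 2.4)

Topic `Literature/NumberTheory/EllipticCurves`; uses the real stabilizer dichotomy of
`BhargavaShankarAveragingRegion.lean` (from Lemma 2.2) and the normal forms of trace-zero elements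
of `GL₂(ℤ)` (`Literature/LinearAlgebra/Matrix/GL2ZTraceZeroNormalForms.lean`). Everything here
is PROVED (no named facts).

Bhargava–Shankar (Ann. of Math. 181 (2015), Lemma 2.4 of `arXiv:1006.1002v2`) bound the number of
integral binary quartic forms in `𝓡_X(hL)` whose stabilizer in `GL₂(ℤ)` has size `> 2` by
`O(X^{3/4+ε})`; their proof (appendix) goes through quartic rings, cubic resolvents and a theorem
of Nakagawa. In the proof of Theorem 2.1 this is only used to discard the `GL₂(ℤ)`-orbits with a
big stabilizer (weights `1/|Stab| < 1/2` in eq. (7)). We prove directly the orbit statement that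
is needed, with the better exponent `2/3`:

* `trace_eq_zero_of_subst_eq`: an integral `γ ≠ ±1` with `f ∘ γ = f` (`Δ(f) ≠ 0`) has trace `0`;
* `exists_equiv_fixed_normal`: hence `f` is `GL₂(ℤ)`-equivalent to a form fixed by
  `γ₁ = diag(1,−1)` (`b = d = 0`), by `γ₂ = (1 1; 0 −1)`, or by `S = (0 −1; 1 0)` (`e = a`,
  `d = −b`);
* counting with `H < Y⁶`: the `γ₁`-family has `8c³ = 6cI − J`, so `|c| ≤ 2Y`, and
  `0 < |ae| ≤ Y²`, giving `≤ 126 Y⁴` forms (`ncard_fix1_le`); the `γ₂`-family embeds into the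
  `γ₁`-family at height `(4Y)⁶` via `f ↦ f ∘ (−2 −1; 0 1)` (`ncard_fix2_le`); the `S`-family has
  `I = 12a² + 3b² + c²`, giving `≤ 27 Y³` forms (`ncard_fixS_le`);
* **`ncard_bigStab_orbits_le`**: the number of `GL₂(ℤ)`-orbits of forms with `Δ ≠ 0`, `H < X`
  and an integral stabilizer element `≠ ±1` is `≤ 32500 · X^{2/3}`.

## References

* M. Bhargava, A. Shankar, Ann. of Math. (2) 181 (2015) 191–242, Lemma 2.4 and its use in §2.3
  (arXiv:1006.1002v2 numbering). [cite: BhargavaShankarAnnals2015, Lemma 2.4 (arXiv:1006.1002v2 numbering)]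
-/

noncomputable section

open Real Matrix Set

namespace Literature.NumberTheory.EllipticCurves

namespace BinaryQuartic

open Literature.LinearAlgebra.Matrix.GL2ZNormalForm

/-! ## Trace zero -/

/-- `f.subst (−γ) = f.subst γ` (degree `4` is even). [folklore] -/
theorem subst_neg_matrix {R : Type*} [CommRing R] (f : BinaryQuartic R) (γ : Matrix (Fin 2) (Fin 2) R) :
    f.subst (-γ) = f.subst γ := by
  ext <;> simp only [subst, Matrix.neg_apply] <;> ring

/-- **A nontrivial integral stabilizer element has trace `0`** (Lemma 2.2 over `ℝ`: the real
stabilizer consists of `±1` and trace-zero elements). [cite: BhargavaShankarAnnals2015, Lemma 2.2 (arXiv:1006.1002v2 numbering)] -/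
theorem trace_eq_zero_of_subst_eq {f : BinaryQuartic ℤ} (hΔ : f.disc ≠ 0) {γ : Matrix (Fin 2) (Fin 2) ℤ}
    (h1 : γ ≠ 1) (h2 : γ ≠ -1) (hfix : f.subst γ = f) : γ 0 0 + γ 1 1 = 0 := by
  have hΔ' : (f.map (Int.castRingHom ℝ)).disc ≠ 0 := by
    rw [disc_map, eq_intCast]; exact_mod_cast hΔ
  have hstab : γ.map (Int.castRingHom ℝ) ∈ substStabilizer (f.map (Int.castRingHom ℝ)) := by
    show (f.map (Int.castRingHom ℝ)).subst (γ.map (Int.castRingHom ℝ)) = f.map (Int.castRingHom ℝ)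
    rw [← map_subst, hfix]
  rcases scalar_or_trace_zero_of_mem_substStabilizer hΔ' hstab with (e | e) | e
  · exfalso; apply h1
    ext i j
    have := congrFun (congrFun e i) j
    simp only [Matrix.map_apply, eq_intCast] at this
    fin_cases i <;> fin_cases j <;> simp at this ⊢ <;> exact_mod_cast this
  · exfalso; apply h2
    ext i j
    have := congrFun (congrFun e i) j
    simp only [Matrix.map_apply, eq_intCast] at this
    fin_cases i <;> fin_cases j <;> simp at this ⊢ <;> exact_mod_cast this
  · simp only [Matrix.map_apply, eq_intCast] at e
    exact_mod_cast e

/-! ## Reduction to the three normal forms -/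

/-- The map `M = (−2 −1; 0 1)` intertwining `γ₂` and `γ₁`: `γ₁ M = M γ₂`. [folklore] -/
def Mγ : Matrix (Fin 2) (Fin 2) ℤ := !![-2, -1; 0, 1]

/-- `γ₁ M = M γ₂`. [folklore] -/
theorem γ₁_mul_Mγ : γ₁ * Mγ = Mγ * γ₂ := by
  rw [γ₁, γ₂, Mγ]; ext i j; fin_cases i <;> fin_cases j <;> simp [Matrix.mul_apply, Fin.sum_univ_two]

/-- `det M = −2`. [folklore] -/
theorem det_Mγ : Mγ.det = -2 := by rw [Mγ, Matrix.det_fin_two_of]; norm_num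

/-- If `f ∘ γ = f` and `γ δ = δ γ₀` with `det δ = 1` then `f' = f ∘ adj(δ)` is `GL₂(ℤ)`-equivalent
to `f` and `f' ∘ γ₀ = f'`. [folklore] -/
theorem exists_equiv_fixed {f : BinaryQuartic ℤ} {γ γ₀ δ : Matrix (Fin 2) (Fin 2) ℤ}
    (hfix : f.subst γ = f) (hδ : δ.det = 1) (hconj : γ * δ = δ * γ₀) :
    GL2ZEquiv f (f.subst δ.adjugate) ∧ (f.subst δ.adjugate).subst γ₀ = f.subst δ.adjugate := by
  refine ⟨⟨δ.adjugate, by rw [Matrix.det_adjugate, hδ]; simp, rfl⟩, ?_⟩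
  have key : γ₀ * δ.adjugate = δ.adjugate * γ := by
    have h1 : δ.adjugate * δ = 1 := by rw [Matrix.adjugate_mul, hδ, one_smul]
    calc γ₀ * δ.adjugate = δ.adjugate * δ * γ₀ * δ.adjugate := by rw [h1, Matrix.one_mul]
      _ = δ.adjugate * (γ * δ) * δ.adjugate := by rw [Matrix.mul_assoc δ.adjugate, ← hconj]
      _ = δ.adjugate * γ * (δ * δ.adjugate) := by simp only [Matrix.mul_assoc]
      _ = δ.adjugate * γ := by rw [Matrix.mul_adjugate, hδ, one_smul, Matrix.mul_one]
  rw [← subst_mul, key, subst_mul, hfix]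

/-- **Every form with a stabilizer element `≠ ±1` is `GL₂(ℤ)`-equivalent to a form fixed by
`γ₁ = diag(1,−1)`, by `γ₂ = (1 1; 0 −1)` or by `S = (0 −1; 1 0)`.** [folklore] -/
theorem exists_equiv_fixed_normal {f : BinaryQuartic ℤ} (hΔ : f.disc ≠ 0) {γ : Matrix (Fin 2) (Fin 2) ℤ}
    (hγ : IsUnit γ.det) (h1 : γ ≠ 1) (h2 : γ ≠ -1) (hfix : f.subst γ = f) :
    ∃ f' : BinaryQuartic ℤ, GL2ZEquiv f f' ∧ (f'.subst γ₁ = f' ∨ f'.subst γ₂ = f' ∨ f'.subst S = f') := by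
  have htr := trace_eq_zero_of_subst_eq hΔ h1 h2 hfix
  have hdet : γ.det = 1 ∨ γ.det = -1 := Int.isUnit_iff.1 hγ
  obtain ⟨δ, hδ, hc⟩ := trace_zero_normal_form γ htr hdet
  rcases hc with hc | hc | hc | hc
  · obtain ⟨he, hf⟩ := exists_equiv_fixed hfix hδ hc; exact ⟨_, he, Or.inl hf⟩
  · obtain ⟨he, hf⟩ := exists_equiv_fixed hfix hδ hc; exact ⟨_, he, Or.inr (Or.inl hf)⟩
  · obtain ⟨he, hf⟩ := exists_equiv_fixed hfix hδ hc; exact ⟨_, he, Or.inr (Or.inr hf)⟩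
  · obtain ⟨he, hf⟩ := exists_equiv_fixed hfix hδ hc
    rw [subst_neg_matrix] at hf
    exact ⟨_, he, Or.inr (Or.inr hf)⟩

/-! ## The fixed forms of the normal forms -/

/-- `f ∘ γ₁ = (a, −b, c, −d, e)`. [folklore] -/
theorem subst_γ₁ (f : BinaryQuartic ℤ) : f.subst γ₁ = ⟨f.a, -f.b, f.c, -f.d, f.e⟩ := by
  rw [γ₁]; ext <;> simp [subst]

/-- `f ∘ S = (e, −d, c, −b, a)`. [folklore] -/
theorem subst_S (f : BinaryQuartic ℤ) : f.subst S = ⟨f.e, -f.d, f.c, -f.b, f.a⟩ := by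
  rw [S]; ext <;> simp [subst]

/-- Forms fixed by `γ₁` have `b = d = 0`. [folklore] -/
theorem bd_of_subst_γ₁ {f : BinaryQuartic ℤ} (h : f.subst γ₁ = f) : f.b = 0 ∧ f.d = 0 := by
  rw [subst_γ₁] at h
  have hb := congrArg BinaryQuartic.b h
  have hd := congrArg BinaryQuartic.d h
  simp only at hb hd
  constructor <;> linarith

/-- Forms fixed by `S` have `e = a`, `d = −b`. [folklore] -/
theorem ae_of_subst_S {f : BinaryQuartic ℤ} (h : f.subst S = f) : f.e = f.a ∧ f.d = -f.b := by
  rw [subst_S] at h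
  have ha := congrArg BinaryQuartic.a h
  have hb := congrArg BinaryQuartic.b h
  simp only at ha hb
  exact ⟨ha, by linarith⟩

/-- Forms fixed by `γ₂` map to forms fixed by `γ₁` under `f ↦ f ∘ M`. [folklore] -/
theorem subst_Mγ_fixed {f : BinaryQuartic ℤ} (h : f.subst γ₂ = f) : (f.subst Mγ).subst γ₁ = f.subst Mγ := by
  rw [← subst_mul, γ₁_mul_Mγ, subst_mul, h]

/-- `f ↦ f ∘ M` is injective. [folklore] -/
theorem subst_Mγ_injective : Function.Injective fun f : BinaryQuartic ℤ => f.subst Mγ := by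
  intro f g h
  have h' := congrArg (fun F : BinaryQuartic ℤ => F.subst Mγ.adjugate) h
  simp only [← subst_mul, Matrix.adjugate_mul, det_Mγ] at h'
  have e : ∀ F : BinaryQuartic ℤ, F.subst ((-2 : ℤ) • (1 : Matrix (Fin 2) (Fin 2) ℤ)) = (16 : ℤ) • F := by
    intro F; ext <;> simp [subst, Matrix.smul_apply] <;> ring
  rw [e, e] at h'
  ext
  · have := congrArg BinaryQuartic.a h'; simp only [smul_a] at this; linarith
  · have := congrArg BinaryQuartic.b h'; simp only [smul_b] at this; linarith
  · have := congrArg BinaryQuartic.c h'; simp only [smul_c] at this; linarith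
  · have := congrArg BinaryQuartic.d h'; simp only [smul_d] at this; linarith
  · have := congrArg BinaryQuartic.e h'; simp only [smul_e] at this; linarith

/-! ## Counting in boxes -/

/-- A set of forms mapped injectively into an integer box `[-N₁,N₁] × [-N₂,N₂] × [-N₃,N₃]` is finite
with at most `(2N₁+1)(2N₂+1)(2N₃+1)` elements. [folklore] -/
theorem finite_and_ncard_le_of_injOn_box {T : Set (BinaryQuartic ℤ)} (φ : BinaryQuartic ℤ → ℤ × ℤ × ℤ)
    (hinj : Set.InjOn φ T) (N₁ N₂ N₃ : ℕ)
    (hb : ∀ f ∈ T, |(φ f).1| ≤ N₁ ∧ |(φ f).2.1| ≤ N₂ ∧ |(φ f).2.2| ≤ N₃) :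
    T.Finite ∧ T.ncard ≤ (2 * N₁ + 1) * (2 * N₂ + 1) * (2 * N₃ + 1) := by
  set B : Set (ℤ × ℤ × ℤ) := ↑(Finset.Icc (-(N₁ : ℤ)) N₁ ×ˢ (Finset.Icc (-(N₂ : ℤ)) N₂ ×ˢ Finset.Icc (-(N₃ : ℤ)) N₃))
    with hB
  have hBfin : B.Finite := Finset.finite_toSet _
  have hmaps : ∀ f ∈ T, φ f ∈ B := by
    intro f hf
    obtain ⟨h1, h2, h3⟩ := hb f hf
    simp only [hB, Finset.coe_product, Finset.coe_Icc, Set.mem_prod, Set.mem_Icc]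
    exact ⟨abs_le.1 h1, abs_le.1 h2, abs_le.1 h3⟩
  have hcard : B.ncard = (2 * N₁ + 1) * (2 * N₂ + 1) * (2 * N₃ + 1) := by
    rw [hB, Set.ncard_coe_finset, Finset.card_product, Finset.card_product, Int.card_Icc, Int.card_Icc,
      Int.card_Icc]
    have e : ∀ N : ℕ, ((N : ℤ) + 1 - -(N : ℤ)).toNat = 2 * N + 1 := by intro N; omega
    rw [e, e, e]; ring
  refine ⟨Set.Finite.of_finite_image (hBfin.subset ?_) hinj, ?_⟩
  · rintro _ ⟨f, hf, rfl⟩; exact hmaps f hf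
  · rw [← hcard]; exact Set.ncard_le_ncard_of_injOn φ hmaps hinj hBfin

/-! ## The three fixed families with bounded height -/

/-- Height bounds: `H(f) < Y⁶` gives `|I| < Y²` and `|J| < 2Y³`. [folklore] -/
theorem invariants_lt_of_height_lt {f : BinaryQuartic ℤ} {Y : ℝ} (hY : 0 ≤ Y) (h : f.height < Y ^ 6) :
    |(f.I : ℝ)| < Y ^ 2 ∧ |(f.J : ℝ)| < 2 * Y ^ 3 := by
  unfold height heightIJ at h
  have hI : |(f.I : ℝ)| ^ 3 < Y ^ 6 := lt_of_le_of_lt (le_max_left _ _) h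
  have hJ : (f.J : ℝ) ^ 2 / 4 < Y ^ 6 := lt_of_le_of_lt (le_max_right _ _) h
  constructor
  · have h3 : |(f.I : ℝ)| ^ 3 < (Y ^ 2) ^ 3 := by rw [← pow_mul]; exact hI
    exact lt_of_pow_lt_pow_left₀ 3 (by positivity) h3
  · have h2 : (f.J : ℝ) ^ 2 < (2 * Y ^ 3) ^ 2 := by nlinarith
    exact abs_lt_of_sq_lt_sq h2 (by positivity)

/-- Forms with `b = d = 0`: `I = 12ae + c²`, `J = 72ace − 2c³`, so `8c³ = 6cI − J`. [folklore] -/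
theorem invariants_of_bd_zero {f : BinaryQuartic ℤ} (hb : f.b = 0) (hd : f.d = 0) :
    f.I = 12 * f.a * f.e + f.c ^ 2 ∧ f.J = 72 * f.a * f.c * f.e - 2 * f.c ^ 3 := by
  simp only [I, J, hb, hd]; constructor <;> ring

/-- **The `γ₁`-fixed family**: forms with `b = d = 0`, `Δ ≠ 0`, `H < Y⁶` (`Y ≥ 1`) have
`|c| ≤ 2Y`, `ae ≠ 0`, `|ae| ≤ Y²`; hence at most `2 · (3Y)(7Y)(3Y²) = 126 Y⁴` of them.
[folklore] -/
theorem fix1_bounds {f : BinaryQuartic ℤ} {Y : ℝ} (hY : 1 ≤ Y) (hb : f.b = 0) (hd : f.d = 0)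
    (hΔ : f.disc ≠ 0) (hH : f.height < Y ^ 6) :
    |(f.c : ℝ)| ≤ 2 * Y ∧ f.a ≠ 0 ∧ f.e ≠ 0 ∧ |(f.a : ℝ)| * |(f.e : ℝ)| ≤ Y ^ 2 := by
  obtain ⟨hI, hJ⟩ := invariants_lt_of_height_lt (by linarith) hH
  obtain ⟨eI, eJ⟩ := invariants_of_bd_zero hb hd
  have eI' : (f.I : ℝ) = 12 * f.a * f.e + (f.c : ℝ) ^ 2 := by exact_mod_cast eI
  have eJ' : (f.J : ℝ) = 72 * f.a * f.c * f.e - 2 * (f.c : ℝ) ^ 3 := by exact_mod_cast eJ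
  have hcube : 8 * (f.c : ℝ) ^ 3 = 6 * f.c * f.I - f.J := by rw [eI', eJ']; ring
  -- `|c| ≤ 2Y`
  have hc : |(f.c : ℝ)| ≤ 2 * Y := by
    by_contra hlt; push Not at hlt
    have hI' := abs_lt.1 hI
    have hJ' := abs_lt.1 hJ
    have habs : 8 * |(f.c : ℝ)| ^ 3 ≤ 6 * |(f.c : ℝ)| * |(f.I : ℝ)| + |(f.J : ℝ)| := by
      have e1 : 8 * |(f.c : ℝ)| ^ 3 = |8 * (f.c : ℝ) ^ 3| := by
        rw [abs_mul, abs_pow]; norm_num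
      rw [e1, hcube]
      calc |6 * (f.c : ℝ) * f.I - f.J| ≤ |6 * (f.c : ℝ) * f.I| + |(f.J : ℝ)| := abs_sub _ _
        _ = 6 * |(f.c : ℝ)| * |(f.I : ℝ)| + |(f.J : ℝ)| := by rw [abs_mul, abs_mul]; norm_num
    have hcpos : 0 < |(f.c : ℝ)| := by linarith
    have h1 : 6 * |(f.c : ℝ)| * |(f.I : ℝ)| ≤ 6 * |(f.c : ℝ)| * Y ^ 2 :=
      mul_le_mul_of_nonneg_left hI.le (by positivity)
    have h2 : 4 * Y ^ 2 < |(f.c : ℝ)| ^ 2 := by nlinarith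
    nlinarith [mul_pos hcpos (by positivity : (0:ℝ) < Y ^ 2), hJ]
  -- `a e ≠ 0`
  have h27 := twentySeven_mul_disc f
  have hae : f.a ≠ 0 ∧ f.e ≠ 0 := by
    constructor
    · intro ha
      apply hΔ
      rw [eI, eJ, ha] at h27
      have : 27 * f.disc = 0 := by rw [h27]; ring
      linarith
    · intro he
      apply hΔ
      rw [eI, eJ, he] at h27
      have : 27 * f.disc = 0 := by rw [h27]; ring
      linarith
  refine ⟨hc, hae.1, hae.2, ?_⟩
  have : 12 * |(f.a : ℝ)| * |(f.e : ℝ)| ≤ |(f.I : ℝ)| + (f.c : ℝ) ^ 2 := by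
    have e1 : 12 * |(f.a : ℝ)| * |(f.e : ℝ)| = |12 * (f.a : ℝ) * f.e| := by rw [abs_mul, abs_mul]; norm_num
    rw [e1, show 12 * (f.a : ℝ) * f.e = f.I - (f.c : ℝ) ^ 2 by rw [eI']; ring]
    calc |(f.I : ℝ) - (f.c : ℝ) ^ 2| ≤ |(f.I : ℝ)| + |(f.c : ℝ) ^ 2| := abs_sub _ _
      _ = _ := by rw [abs_pow, sq_abs]
  have hc2 : (f.c : ℝ) ^ 2 ≤ 4 * Y ^ 2 := by
    have := abs_le.1 hc; nlinarith [sq_abs (f.c : ℝ)]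
  nlinarith [hI.le]

/-- The `γ₁`-fixed family with `H < Y⁶` is finite with at most `126 Y⁴` elements. [folklore] -/
theorem ncard_fix1_le {Y : ℝ} (hY : 1 ≤ Y) :
    ({f : BinaryQuartic ℤ | f.b = 0 ∧ f.d = 0 ∧ f.disc ≠ 0 ∧ f.height < Y ^ 6}).Finite ∧
      (({f : BinaryQuartic ℤ | f.b = 0 ∧ f.d = 0 ∧ f.disc ≠ 0 ∧ f.height < Y ^ 6}).ncard : ℝ) ≤ 126 * Y ^ 4 := by
  set T := {f : BinaryQuartic ℤ | f.b = 0 ∧ f.d = 0 ∧ f.disc ≠ 0 ∧ f.height < Y ^ 6}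
  -- split according to `|a| ≤ Y` or `|e| ≤ Y`
  set TA := {f ∈ T | |(f.a : ℝ)| ≤ Y}
  set TE := {f ∈ T | |(f.e : ℝ)| ≤ Y}
  have hcover : T ⊆ TA ∪ TE := by
    intro f hf
    obtain ⟨-, -, -, hprod⟩ := fix1_bounds hY hf.1 hf.2.1 hf.2.2.1 hf.2.2.2
    by_cases ha : |(f.a : ℝ)| ≤ Y
    · exact Or.inl ⟨hf, ha⟩
    · right; refine ⟨hf, ?_⟩
      push Not at ha
      by_contra he; push Not at he
      have : Y * Y < |(f.a : ℝ)| * |(f.e : ℝ)| := mul_lt_mul'' ha he (by linarith) (by linarith)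
      nlinarith
  have φinj : Set.InjOn (fun f : BinaryQuartic ℤ => (f.a, f.c, f.e)) T := by
    intro f hf g hg h
    simp only [Prod.mk.injEq] at h
    obtain ⟨h1, h2, h3⟩ := h
    ext
    · exact h1
    · rw [hf.1, hg.1]
    · exact h2
    · rw [hf.2.1, hg.2.1]
    · exact h3
  set N : ℕ := ⌊Y⌋₊ with hN
  set N2 : ℕ := ⌊Y ^ 2⌋₊ with hN2
  have hNY : (N : ℝ) ≤ Y := Nat.floor_le (by linarith)
  have hN2Y : (N2 : ℝ) ≤ Y ^ 2 := Nat.floor_le (by positivity)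
  have hintle : ∀ {z : ℤ} {B : ℝ} {M : ℕ}, M = ⌊B⌋₊ → 0 ≤ B → |(z : ℝ)| ≤ B → |z| ≤ (M : ℤ) := by
    intro z B M hM hB hz
    rw [hM]
    have h1 : ((|z| : ℤ) : ℝ) ≤ B := by push_cast; exact hz
    have h2 : (|z|).toNat ≤ ⌊B⌋₊ := Nat.le_floor (by rw [← Int.cast_natCast, Int.toNat_of_nonneg (abs_nonneg z)]; exact h1)
    have := Int.toNat_of_nonneg (abs_nonneg z)
    omega
  have hbA : ∀ f ∈ TA, |((fun f : BinaryQuartic ℤ => (f.a, f.c, f.e)) f).1| ≤ (N : ℤ) ∧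
      |((fun f : BinaryQuartic ℤ => (f.a, f.c, f.e)) f).2.1| ≤ ((2 * N + 1 : ℕ) : ℤ) ∧
      |((fun f : BinaryQuartic ℤ => (f.a, f.c, f.e)) f).2.2| ≤ (N2 : ℤ) := by
    rintro f ⟨hf, ha⟩
    obtain ⟨hc, ha0, he0, hprod⟩ := fix1_bounds hY hf.1 hf.2.1 hf.2.2.1 hf.2.2.2
    have hcint : |f.c| ≤ ((2 * N + 1 : ℕ) : ℤ) := by
      have hfl := Nat.lt_floor_add_one Y
      rw [← hN] at hfl
      have h1 : ((|f.c| : ℤ) : ℝ) < 2 * N + 2 := by rw [Int.cast_abs]; linarith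
      have h2 : |f.c| < 2 * (N : ℤ) + 2 := by exact_mod_cast h1
      push_cast; omega
    refine ⟨hintle hN (by linarith) ha, hcint, hintle hN2 (by positivity) ?_⟩
    · have h1 : 1 ≤ |(f.a : ℝ)| := by
        have : (1 : ℤ) ≤ |f.a| := Int.one_le_abs ha0
        exact_mod_cast this
      nlinarith [abs_nonneg (f.e : ℝ)]
  have hbE : ∀ f ∈ TE, |((fun f : BinaryQuartic ℤ => (f.a, f.c, f.e)) f).1| ≤ (N2 : ℤ) ∧
      |((fun f : BinaryQuartic ℤ => (f.a, f.c, f.e)) f).2.1| ≤ ((2 * N + 1 : ℕ) : ℤ) ∧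
      |((fun f : BinaryQuartic ℤ => (f.a, f.c, f.e)) f).2.2| ≤ (N : ℤ) := by
    rintro f ⟨hf, he⟩
    obtain ⟨hc, ha0, he0, hprod⟩ := fix1_bounds hY hf.1 hf.2.1 hf.2.2.1 hf.2.2.2
    have hcint : |f.c| ≤ ((2 * N + 1 : ℕ) : ℤ) := by
      have hfl := Nat.lt_floor_add_one Y
      rw [← hN] at hfl
      have h1 : ((|f.c| : ℤ) : ℝ) < 2 * N + 2 := by rw [Int.cast_abs]; linarith
      have h2 : |f.c| < 2 * (N : ℤ) + 2 := by exact_mod_cast h1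
      push_cast; omega
    refine ⟨hintle hN2 (by positivity) ?_, hcint, hintle hN (by linarith) he⟩
    · have h1 : 1 ≤ |(f.e : ℝ)| := by
        have : (1 : ℤ) ≤ |f.e| := Int.one_le_abs he0
        exact_mod_cast this
      nlinarith [abs_nonneg (f.a : ℝ)]
  obtain ⟨hfinA, hcardA⟩ := finite_and_ncard_le_of_injOn_box _ (φinj.mono (fun f hf => hf.1)) N (2 * N + 1) N2 hbA
  obtain ⟨hfinE, hcardE⟩ := finite_and_ncard_le_of_injOn_box _ (φinj.mono (fun f hf => hf.1)) N2 (2 * N + 1) N hbE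
  have hfin : T.Finite := (hfinA.union hfinE).subset hcover
  refine ⟨hfin, ?_⟩
  have h1 : T.ncard ≤ TA.ncard + TE.ncard :=
    (Set.ncard_le_ncard hcover (hfinA.union hfinE)).trans (Set.ncard_union_le _ _)
  have h2 : (T.ncard : ℝ) ≤ (2 * N + 1) * (2 * (2 * N + 1) + 1) * (2 * N2 + 1) + (2 * N2 + 1) * (2 * (2 * N + 1) + 1) * (2 * N + 1) := by
    have := h1.trans (Nat.add_le_add hcardA hcardE)
    exact_mod_cast this
  have t1 : (2 * (N : ℝ) + 1) ≤ 3 * Y := by linarith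
  have t2 : (2 * (2 * (N : ℝ) + 1) + 1) ≤ 7 * Y := by linarith
  have t3 : (2 * (N2 : ℝ) + 1) ≤ 3 * Y ^ 2 := by nlinarith
  have p1 : (2 * (N : ℝ) + 1) * (2 * (2 * (N : ℝ) + 1) + 1) * (2 * (N2 : ℝ) + 1) ≤ 3 * Y * (7 * Y) * (3 * Y ^ 2) := by
    apply mul_le_mul (mul_le_mul t1 t2 (by positivity) (by positivity)) t3 (by positivity) (by positivity)
  have p2 : (2 * (N2 : ℝ) + 1) * (2 * (2 * (N : ℝ) + 1) + 1) * (2 * (N : ℝ) + 1) ≤ 3 * Y ^ 2 * (7 * Y) * (3 * Y) := by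
    apply mul_le_mul (mul_le_mul t3 t2 (by positivity) (by positivity)) t1 (by positivity) (by positivity)
  nlinarith [p1, p2, h2]

/-- **The `S`-fixed family**: forms with `e = a`, `d = −b` and `H < Y⁶` have
`I = 12a² + 3b² + c² < Y²`, so at most `(2Y+1)³ ≤ 27 Y³` of them. [folklore] -/
theorem ncard_fixS_le {Y : ℝ} (hY : 1 ≤ Y) :
    ({f : BinaryQuartic ℤ | f.e = f.a ∧ f.d = -f.b ∧ f.height < Y ^ 6}).Finite ∧
      (({f : BinaryQuartic ℤ | f.e = f.a ∧ f.d = -f.b ∧ f.height < Y ^ 6}).ncard : ℝ) ≤ 27 * Y ^ 3 := by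
  set T := {f : BinaryQuartic ℤ | f.e = f.a ∧ f.d = -f.b ∧ f.height < Y ^ 6}
  set N : ℕ := ⌊Y⌋₊ with hN
  have hNY : (N : ℝ) ≤ Y := Nat.floor_le (by linarith)
  have hintlt : ∀ {z : ℤ}, |(z : ℝ)| < Y → |z| ≤ (N : ℤ) := by
    intro z hz
    have hfl := Nat.lt_floor_add_one Y
    rw [← hN] at hfl
    have h1 : ((|z| : ℤ) : ℝ) < N + 1 := by rw [Int.cast_abs]; linarith
    have h2 : |z| < (N : ℤ) + 1 := by exact_mod_cast h1
    omega
  have φinj : Set.InjOn (fun f : BinaryQuartic ℤ => (f.a, f.b, f.c)) T := by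
    intro f hf g hg h
    simp only [Prod.mk.injEq] at h
    obtain ⟨h1, h2, h3⟩ := h
    ext
    · exact h1
    · exact h2
    · exact h3
    · rw [hf.2.1, hg.2.1, h2]
    · rw [hf.1, hg.1, h1]
  have hb : ∀ f ∈ T, |((fun f : BinaryQuartic ℤ => (f.a, f.b, f.c)) f).1| ≤ (N : ℤ) ∧
      |((fun f : BinaryQuartic ℤ => (f.a, f.b, f.c)) f).2.1| ≤ (N : ℤ) ∧
      |((fun f : BinaryQuartic ℤ => (f.a, f.b, f.c)) f).2.2| ≤ (N : ℤ) := by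
    intro f hf
    obtain ⟨he, hd, hH⟩ := hf
    obtain ⟨hI, -⟩ := invariants_lt_of_height_lt (by linarith) hH
    have eI : f.I = 12 * f.a ^ 2 + 3 * f.b ^ 2 + f.c ^ 2 := by simp only [I, he, hd]; ring
    have eI' : (f.I : ℝ) = 12 * (f.a : ℝ) ^ 2 + 3 * (f.b : ℝ) ^ 2 + (f.c : ℝ) ^ 2 := by exact_mod_cast eI
    have hI' : (f.I : ℝ) < Y ^ 2 := (abs_lt.1 hI).2
    have hY0 : 0 ≤ Y := by linarith
    refine ⟨hintlt (abs_lt_of_sq_lt_sq (by nlinarith [sq_nonneg (f.b : ℝ), sq_nonneg (f.c : ℝ)]) hY0),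
      hintlt (abs_lt_of_sq_lt_sq (by nlinarith [sq_nonneg (f.a : ℝ), sq_nonneg (f.c : ℝ)]) hY0),
      hintlt (abs_lt_of_sq_lt_sq (by nlinarith [sq_nonneg (f.a : ℝ), sq_nonneg (f.b : ℝ)]) hY0)⟩
  obtain ⟨hfin, hcard⟩ := finite_and_ncard_le_of_injOn_box _ φinj N N N hb
  refine ⟨hfin, ?_⟩
  have h2 : (T.ncard : ℝ) ≤ (2 * N + 1) * (2 * N + 1) * (2 * N + 1) := by exact_mod_cast hcard
  have t1 : (2 * (N : ℝ) + 1) ≤ 3 * Y := by linarith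
  have p1 : (2 * (N : ℝ) + 1) * (2 * N + 1) * (2 * N + 1) ≤ 3 * Y * (3 * Y) * (3 * Y) :=
    mul_le_mul (mul_le_mul t1 t1 (by positivity) (by positivity)) t1 (by positivity) (by positivity)
  nlinarith

/-- **The `γ₂`-fixed family** embeds into the `γ₁`-fixed family at height `< (4Y)⁶` by
`f ↦ f ∘ M`, so it is finite with at most `126 · 4⁴ Y⁴` elements. [folklore] -/
theorem ncard_fix2_le {Y : ℝ} (hY : 1 ≤ Y) :
    ({f : BinaryQuartic ℤ | f.subst γ₂ = f ∧ f.disc ≠ 0 ∧ f.height < Y ^ 6}).Finite ∧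
      (({f : BinaryQuartic ℤ | f.subst γ₂ = f ∧ f.disc ≠ 0 ∧ f.height < Y ^ 6}).ncard : ℝ) ≤ 32256 * Y ^ 4 := by
  set T := {f : BinaryQuartic ℤ | f.subst γ₂ = f ∧ f.disc ≠ 0 ∧ f.height < Y ^ 6}
  have hY4 : (1 : ℝ) ≤ 4 * Y := by linarith
  obtain ⟨hfin1, hcard1⟩ := ncard_fix1_le hY4
  set T1 := {f : BinaryQuartic ℤ | f.b = 0 ∧ f.d = 0 ∧ f.disc ≠ 0 ∧ f.height < (4 * Y) ^ 6}
  have hmaps : ∀ f ∈ T, f.subst Mγ ∈ T1 := by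
    intro f hf
    obtain ⟨hfix, hΔ, hH⟩ := hf
    obtain ⟨hb, hd⟩ := bd_of_subst_γ₁ (subst_Mγ_fixed hfix)
    refine ⟨hb, hd, ?_, ?_⟩
    · rw [disc_subst, det_Mγ]; exact mul_ne_zero (by norm_num) hΔ
    · unfold height heightIJ at hH ⊢
      rw [I_subst, J_subst, det_Mγ]
      push_cast
      have h1 : |(16 : ℝ) * (f.I : ℝ)| ^ 3 = 4096 * |(f.I : ℝ)| ^ 3 := by
        rw [abs_mul, mul_pow]; norm_num
      have h2 : ((64 : ℝ) * (f.J : ℝ)) ^ 2 / 4 = 4096 * ((f.J : ℝ) ^ 2 / 4) := by ring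
      rw [h1, h2, ← mul_max_of_nonneg _ _ (by norm_num : (0:ℝ) ≤ 4096)]
      calc (4096 : ℝ) * max (|(f.I : ℝ)| ^ 3) ((f.J : ℝ) ^ 2 / 4) < 4096 * Y ^ 6 :=
            mul_lt_mul_of_pos_left hH (by norm_num)
        _ = (4 * Y) ^ 6 := by ring
  have hinj : Set.InjOn (fun f : BinaryQuartic ℤ => f.subst Mγ) T := subst_Mγ_injective.injOn
  have hle := Set.ncard_le_ncard_of_injOn (fun f : BinaryQuartic ℤ => f.subst Mγ) hmaps hinj hfin1
  refine ⟨Set.Finite.of_finite_image (hfin1.subset ?_) hinj, ?_⟩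
  · rintro _ ⟨f, hf, rfl⟩; exact hmaps f hf
  · calc ((T.ncard : ℕ) : ℝ) ≤ (T1.ncard : ℝ) := by exact_mod_cast hle
      _ ≤ 126 * (4 * Y) ^ 4 := hcard1
      _ = 32256 * Y ^ 4 := by ring

/-! ## The number of orbits with a big stabilizer -/

/-- **Orbits with a stabilizer of size `> 2` are negligible** (an elementary substitute for
Bhargava–Shankar's Lemma 2.4, whose printed bound is `O(X^{3/4+ε})` via quartic rings): the number
of `GL₂(ℤ)`-orbits of integral binary quartic forms with `Δ ≠ 0`, `H < X` and an integral
stabilizer element `≠ ±1` is at most `32500 · X^{2/3}`. Every such orbit contains a form fixed by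
`diag(1,−1)`, `(1 1; 0 −1)` or `S` (normal forms of trace-zero elements of `GL₂(ℤ)`), and these
are counted through their invariants. [cite: BhargavaShankarAnnals2015, Lemma 2.4 (arXiv:1006.1002v2 numbering); elementary proof] -/
theorem ncard_bigStab_orbits_le {X : ℝ} (hX : 1 ≤ X) :
    ((gl2zOrbit '' {f : BinaryQuartic ℤ | f.disc ≠ 0 ∧ f.height < X ∧
        ∃ γ : Matrix (Fin 2) (Fin 2) ℤ, IsUnit γ.det ∧ γ ≠ 1 ∧ γ ≠ -1 ∧ f.subst γ = f}).ncard : ℝ) ≤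
      32500 * X ^ (2 / 3 : ℝ) := by
  have hX0 : 0 ≤ X := by linarith
  set Y : ℝ := X ^ (1 / 6 : ℝ) with hYdef
  have hY1 : 1 ≤ Y := Real.one_le_rpow hX (by norm_num)
  have hY6 : Y ^ 6 = X := by
    rw [hYdef, ← Real.rpow_natCast, ← Real.rpow_mul hX0]; norm_num
  have hY4 : Y ^ 4 = X ^ (2 / 3 : ℝ) := by
    rw [hYdef, ← Real.rpow_natCast, ← Real.rpow_mul hX0]; norm_num
  set Big := {f : BinaryQuartic ℤ | f.disc ≠ 0 ∧ f.height < X ∧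
        ∃ γ : Matrix (Fin 2) (Fin 2) ℤ, IsUnit γ.det ∧ γ ≠ 1 ∧ γ ≠ -1 ∧ f.subst γ = f}
  set T1 := {f : BinaryQuartic ℤ | f.b = 0 ∧ f.d = 0 ∧ f.disc ≠ 0 ∧ f.height < Y ^ 6}
  set T2 := {f : BinaryQuartic ℤ | f.subst γ₂ = f ∧ f.disc ≠ 0 ∧ f.height < Y ^ 6}
  set TS := {f : BinaryQuartic ℤ | f.e = f.a ∧ f.d = -f.b ∧ f.height < Y ^ 6}
  obtain ⟨hfin1, hcard1⟩ := ncard_fix1_le hY1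
  obtain ⟨hfin2, hcard2⟩ := ncard_fix2_le hY1
  obtain ⟨hfinS, hcardS⟩ := ncard_fixS_le hY1
  have hsub : gl2zOrbit '' Big ⊆ gl2zOrbit '' (T1 ∪ T2 ∪ TS) := by
    rintro _ ⟨f, ⟨hΔ, hH, γ, hγ, h1, h2, hfix⟩, rfl⟩
    obtain ⟨f', hequiv, hf'⟩ := exists_equiv_fixed_normal hΔ hγ h1 h2 hfix
    obtain ⟨δ, hδ, rfl⟩ := hequiv
    have hΔ' : (f.subst δ).disc ≠ 0 := by
      rw [disc_subst]; exact mul_ne_zero (pow_ne_zero _ hδ.ne_zero) hΔ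
    have hH' : (f.subst δ).height < Y ^ 6 := by rw [height_subst_of_isUnit f hδ, hY6]; exact hH
    refine ⟨f.subst δ, ?_, (gl2zOrbit_eq_of_equiv ⟨δ, hδ, rfl⟩).symm⟩
    rcases hf' with h | h | h
    · obtain ⟨hb, hd⟩ := bd_of_subst_γ₁ h
      exact Or.inl (Or.inl ⟨hb, hd, hΔ', hH'⟩)
    · exact Or.inl (Or.inr ⟨h, hΔ', hH'⟩)
    · obtain ⟨he, hd⟩ := ae_of_subst_S h
      exact Or.inr ⟨he, hd, hH'⟩
  have hfinU : (T1 ∪ T2 ∪ TS).Finite := (hfin1.union hfin2).union hfinS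
  have h1 : (gl2zOrbit '' Big).ncard ≤ (T1 ∪ T2 ∪ TS).ncard :=
    (Set.ncard_le_ncard hsub (hfinU.image _)).trans (Set.ncard_image_le hfinU)
  have h2 : (T1 ∪ T2 ∪ TS).ncard ≤ T1.ncard + T2.ncard + TS.ncard :=
    (Set.ncard_union_le _ _).trans (Nat.add_le_add_right (Set.ncard_union_le _ _) _)
  have h3 : ((gl2zOrbit '' Big).ncard : ℝ) ≤ T1.ncard + T2.ncard + TS.ncard := by exact_mod_cast h1.trans h2
  have hY34 : Y ^ 3 ≤ Y ^ 4 := pow_le_pow_right₀ hY1 (by norm_num)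
  rw [← hY4]
  linarith

end BinaryQuartic

end Literature.NumberTheory.EllipticCurves

end
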